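import Summits.KontsevichZagierPeriods.KontsevichZagierPeriods.Theses.HurwitzMicroSectors
import Summits.KontsevichZagierPeriods.KontsevichZagierPeriods.Theorems.HurwitzMicroSectorsNormalFormPrinciplePiBoxTransfer
import Summits.KontsevichZagierPeriods.KontsevichZagierPeriods.Theorems.HurwitzMicroSectorsNormalFormPrincipleVariants2265

/-! TTRL-lite variant V2270 of stmt-KontsevichZagierPeriods-3869

Variant V2270 = `stub_boxRigidity` (the leaf `BoxRigidity` of `NormalFormPrinciple`: two BOX-RATIONAL
representations — domain the open unit box, integrand `p/q` over `ℚ`, `q ≠ 0` on the box — with equal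
values are KZ-equivalent) under the move `bound_nat:m≤4; bound_nat:m'≤3` (both dimensions BOUNDED).
Verdict of the attempt seat: **open** — this file is the exact-strength certificate, not a proof:

* `stub_boxRigidity_var2270_iff_boxVanishing_four`: V2270 ⟺ **BoxVanishing(4)** (every box-rational
  representation on `(0,1)⁴` of value `0` is a relation): ⇒ specialise to `(m, m') = (4, 2)`, which is the
  sibling V2265, and compare with the zero representation on the square (file `…Variants2265`); ⇐ pad both
  sides to the `4`-box and subtract there (`boxRigidityLe_four_of_boxVanishing_four_var2265`, same file);
* hence `stub_boxRigidity_var2270_iff_var2265` (V2270 is LITERALLY EQUIVALENT to the frozen sibling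
  V2265, and by `…Variants2268` to V2268 = its own frozen instance `(4, 3)`: bounding instead of freezing,
  and the bound on the smaller dimension, are both idle) and `stub_boxRigidity_var2270_iff_boxRigidityLe_four`
  (⟺ Conjecture 1 of Kontsevich–Zagier for every pair of rational integrands on the boxes `(0,1)^{≤ 4}`);
* `stub_boxRigidity_var2270_of_parent` / `_of_statement`: parent leaf ⇒ V2270 and Summit ⇒ V2270, so a
  refutation of the variant would refute `KontsevichZagierPeriods` (the tree has no invariant of
  `KZ.relations` finer than `eval`, and `eval` cannot separate two representations with equal values).
The residual goal is BoxVanishing(4) (already its rung `2` — Catalan's `G = ∫∫ dxdy/(1 + x²y²)` against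
`a + bπ²`, needing the open `Indep_ℚ(1, π², G)` or an unknown chain of moves — is open).
Source: M. Kontsevich, D. Zagier, *Periods* (2001), §1.2 Conjecture 1. Pure proof file, no definitions. -/

-- `Summit.<Summit>.<Problem>` is the tree's mandated summit-side namespace (CONVENTIONS §2); for this
-- single-conjunct summit the two coincide, so the duplicate is deliberate.
set_option linter.dupNamespace false

noncomputable section

namespace Summit.KontsevichZagierPeriods.KontsevichZagierPeriods.Theorems

open MeasureTheory Set
open Literature.NumberTheory.Transcendental Literature.NumberTheory.Transcendental.KZ
open Summit.KontsevichZagierPeriods.KontsevichZagierPeriods.Theses.HurwitzMicroSectors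
open Summit.KontsevichZagierPeriods.HurwitzMicroSectors.NormalFormPrinciple.PiBox

/-- **V2270 ⇒ BoxVanishing(4)**: specialise the bounded variant to `(m, m') = (4, 2)` (the sibling V2265)
and compare a vanishing `N : IntegralRep 4` with the zero representation on the square.
[cite: KontsevichZagier2001, §1.2 Conjecture 1] -/
theorem boxVanishing_four_of_stub_boxRigidity_var2270
    (h : ∀ (m m' : ℕ) (N : IntegralRep m) (N' : IntegralRep m'), m' ≤ 3 → m ≤ 4 → N.domain = {x | ∀ i, x i ∈ Set.Ioo (0:ℝ) 1} → N.IsRational → N'.domain = {x | ∀ i, x i ∈ Set.Ioo (0:ℝ) 1} → N'.IsRational → N.value = N'.value → Equivalent N N') :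
    ∀ N : IntegralRep 4, N.domain = {x | ∀ i, x i ∈ Set.Ioo (0:ℝ) 1} → N.IsRational →
      N.value = 0 → of N ∈ relations :=
  boxVanishing_four_of_stub_boxRigidity_var2265 fun N N' => h 4 2 N N' (Nat.le_succ 2) le_rfl

/-- **BoxVanishing(4) ⇒ V2270**: pad both representations to the `4`-box by unit intervals and subtract
on the common box; the difference is box-rational of value `0` by soundness.
[cite: KontsevichZagier2001, §1.2 Conjecture 1] -/
theorem stub_boxRigidity_var2270_of_boxVanishing_four
    (hvan : ∀ N : IntegralRep 4, N.domain = {x | ∀ i, x i ∈ Set.Ioo (0:ℝ) 1} → N.IsRational →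
      N.value = 0 → of N ∈ relations) :
    ∀ (m m' : ℕ) (N : IntegralRep m) (N' : IntegralRep m'), m' ≤ 3 → m ≤ 4 → N.domain = {x | ∀ i, x i ∈ Set.Ioo (0:ℝ) 1} → N.IsRational → N'.domain = {x | ∀ i, x i ∈ Set.Ioo (0:ℝ) 1} → N'.IsRational → N.value = N'.value → Equivalent N N' :=
  fun _ _ N N' hm' hm =>
    boxRigidityLe_four_of_boxVanishing_four_var2265 hvan hm (hm'.trans (Nat.le_succ 3)) N N'

/-- **V2270 ⟺ BoxVanishing(4)**: the bounded instance `m ≤ 4`, `m' ≤ 3` of `stub_boxRigidity` is exactly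
the statement that every box-rational representation on `(0,1)⁴` of value `0` is a relation.
[cite: KontsevichZagier2001, §1.2 Conjecture 1] -/
theorem stub_boxRigidity_var2270_iff_boxVanishing_four :
    (∀ (m m' : ℕ) (N : IntegralRep m) (N' : IntegralRep m'), m' ≤ 3 → m ≤ 4 → N.domain = {x | ∀ i, x i ∈ Set.Ioo (0:ℝ) 1} → N.IsRational → N'.domain = {x | ∀ i, x i ∈ Set.Ioo (0:ℝ) 1} → N'.IsRational → N.value = N'.value → Equivalent N N') ↔
    (∀ N : IntegralRep 4, N.domain = {x | ∀ i, x i ∈ Set.Ioo (0:ℝ) 1} → N.IsRational →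
      N.value = 0 → of N ∈ relations) :=
  ⟨boxVanishing_four_of_stub_boxRigidity_var2270, stub_boxRigidity_var2270_of_boxVanishing_four⟩

/-- **V2270 ⟺ V2265**: bounding the dimensions by `(4, 3)` and freezing them at `(4, 2)` give literally
equivalent statements (both are BoxVanishing(4)). [cite: KontsevichZagier2001, §1.2 Conjecture 1] -/
theorem stub_boxRigidity_var2270_iff_var2265 :
    (∀ (m m' : ℕ) (N : IntegralRep m) (N' : IntegralRep m'), m' ≤ 3 → m ≤ 4 → N.domain = {x | ∀ i, x i ∈ Set.Ioo (0:ℝ) 1} → N.IsRational → N'.domain = {x | ∀ i, x i ∈ Set.Ioo (0:ℝ) 1} → N'.IsRational → N.value = N'.value → Equivalent N N') ↔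
    (∀ (N : IntegralRep 4) (N' : IntegralRep 2), N.domain = {x | ∀ i, x i ∈ Set.Ioo (0:ℝ) 1} → N.IsRational → N'.domain = {x | ∀ i, x i ∈ Set.Ioo (0:ℝ) 1} → N'.IsRational → N.value = N'.value → Equivalent N N') :=
  stub_boxRigidity_var2270_iff_boxVanishing_four.trans stub_boxRigidity_var2265_iff_boxVanishing_four.symm

/-- **V2270 ⟺ BoxRigidity with both dimensions `≤ 4`**: the bound `m' ≤ 3` is idle (Conjecture 1 for all
pairs of rational integrands on the open unit boxes of dimension at most `4`).
[cite: KontsevichZagier2001, §1.2 Conjecture 1] -/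
theorem stub_boxRigidity_var2270_iff_boxRigidityLe_four :
    (∀ (m m' : ℕ) (N : IntegralRep m) (N' : IntegralRep m'), m' ≤ 3 → m ≤ 4 → N.domain = {x | ∀ i, x i ∈ Set.Ioo (0:ℝ) 1} → N.IsRational → N'.domain = {x | ∀ i, x i ∈ Set.Ioo (0:ℝ) 1} → N'.IsRational → N.value = N'.value → Equivalent N N') ↔
    (∀ (m m' : ℕ) (N : IntegralRep m) (N' : IntegralRep m'), m ≤ 4 → m' ≤ 4 →
      N.domain = {x | ∀ i, x i ∈ Set.Ioo (0:ℝ) 1} → N.IsRational →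
      N'.domain = {x | ∀ i, x i ∈ Set.Ioo (0:ℝ) 1} → N'.IsRational →
      N.value = N'.value → Equivalent N N') :=
  stub_boxRigidity_var2270_iff_var2265.trans stub_boxRigidity_var2265_iff_boxRigidityLe_four

/-- **Parent ⇒ V2270** (the variant specialises the leaf `stub_boxRigidity`; the converse is not claimed —
the parent is BoxVanishing in ALL dimensions). [cite: KontsevichZagier2001, §1.2 Conjecture 1] -/
theorem stub_boxRigidity_var2270_of_parent
    (h : ∀ (m m' : ℕ) (N : IntegralRep m) (N' : IntegralRep m'), N.domain = {x | ∀ i, x i ∈ Set.Ioo (0:ℝ) 1} → N.IsRational → N'.domain = {x | ∀ i, x i ∈ Set.Ioo (0:ℝ) 1} → N'.IsRational → N.value = N'.value → Equivalent N N') :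
    ∀ (m m' : ℕ) (N : IntegralRep m) (N' : IntegralRep m'), m' ≤ 3 → m ≤ 4 → N.domain = {x | ∀ i, x i ∈ Set.Ioo (0:ℝ) 1} → N.IsRational → N'.domain = {x | ∀ i, x i ∈ Set.Ioo (0:ℝ) 1} → N'.IsRational → N.value = N'.value → Equivalent N N' :=
  fun m m' N N' _ _ => h m m' N N'

/-- **`KontsevichZagierPeriods ⇒ V2270`**: the variant is a special case of Conjecture 1 for the tree's
calculus — a refutation of the variant would refute the Summit. [cite: KontsevichZagier2001, §1.2 Conjecture 1] -/
theorem stub_boxRigidity_var2270_of_statement (h : _root_.KontsevichZagierPeriods) :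
    ∀ (m m' : ℕ) (N : IntegralRep m) (N' : IntegralRep m'), m' ≤ 3 → m ≤ 4 → N.domain = {x | ∀ i, x i ∈ Set.Ioo (0:ℝ) 1} → N.IsRational → N'.domain = {x | ∀ i, x i ∈ Set.Ioo (0:ℝ) 1} → N'.IsRational → N.value = N'.value → Equivalent N N' :=
  stub_boxRigidity_var2270_of_parent (leaves_of_statement h).1

end Summit.KontsevichZagierPeriods.KontsevichZagierPeriods.Theorems
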